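import Summits.QuantumFields.YangMills.Theorems.BalabanUVNodesN21RegularityTransferJunction
import Summits.QuantumFields.YangMills.Theorems.BalabanUVNodesN21ShellFactorJunction

/-!
# YM-DAG node N21 (= NE7c) — THE N07 ⊗ N12 ⊗ N20 JUNCTION AT NODE 00's MINIMISER OF RECORD: n21-a's per-slot shell RATIO
# (`BalabanUVNodesN21ShellFactorJunction`, p409431: pointwise [B15] p. 193 factor ⊗ NE7b-type normalisation ratio) with its three
# template binders `hext`, `hreg`, `hcmp` DISCHARGED BY NAME — `hext := B15ShellGauge193.extension193_shell_box` (Λ a parallelepiped,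
# `d = 4`), `hreg := N21RegularityTransferJunction.hreg_Uk_of_thm1_objects` (file 1, p454585: N07's Theorem-1 slot at the T-carrier
# family + ₈a's rows), `hcmp := B15Chi175LargeFieldFactor.hcmp_specialUnitaryGroup` (`G = SU(N)`, `c_G = 2N`)

Track A of `YM-PLAN.md` (cell `pub-ymgap`, HUMAN RULING D-0062), node **N21**, fan-out row s1; seat `pub-ymgap-dag-n21-c`, generation 0, file 2.
Kernel bookkeeping BY NAME over LANDED modules only: file 1 `BalabanUVNodesN21RegularityTransferJunction` (p454585) and n21-a's file 2
`BalabanUVNodesN21ShellFactorJunction` (p409431: `shellBelow_mul_exp_neg_wilsonLoc_le_half`, `exp_neg_wilsonLoc_eq_half_mul_half`,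
`integral_shell_le_of_pointwise_of_ratio`, `sum_integral_shell_le_of_ratio`, `integral_shell_wilson_le_of_ratio`).  0 `def`, 0 `sorry`,
standard axioms.  COUNT-NEUTRAL; `--supports` the K3 item `SpineGivenEndpointR11`.

WHAT IS PROVED ([folklore] compositions; `U_k(W) := Node00.Uk F N K k ε₀ W`, `η_k := (F.P K).eta k`; the displayed inputs throughout are
N07's Theorem-1 slot at the member `hT1` and ₈a's rows for regular data `hUk` — file 1's section hypotheses VERBATIM —, the numeric window
`ε₀ ≤ a₀`, `0 < B₃`, and per theorem the slot-side data).
* §1 POINTWISE, AT HALF WEIGHT (the other half carried along, `exp(−A(ζ)) = exp(−A(ζ∕2))²`):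
  `shellBelow_mul_exp_neg_wilsonLoc_le_half_box_Uk` — the (1.75) form for print's `Λ` = a parallelepiped:
  `1[2ε_kη_k² − Δ ≤ u < 2ε_kη_k²]·e^{−A(ζ,V)} ≤ e^{−(w∕2)(2N)⁻¹(((48d+1)B₃M²)⁻¹ε′)²}·e^{−A(ζ∕2,V)}` for any tested variable `u` whose lowered
  large-field event `{2ε′η_k² ≤ u}` implies `χ_{k,Λ}(V) = 0` read through `U_k`; `shellBelow_mul_exp_neg_wilsonLoc_le_half_of_Uk_dev_ge` — the
  (2.17) form ([Balaban1988Convergent] p. 257, background tested directly): the shell `1[θ' − Δ ≤ u < θ']` of ANY tested variable whose LOWERED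
  large-field event `{θ' − Δ ≤ u}` forces a `(θ' − Δ)`-large plaquette of `U_k(V)` on `S` carries
  `e^{−(w∕2)(2N)⁻¹(B₃⁻¹η_k⁻²(θ' − Δ))²}·e^{−A(ζ∕2,V)}` (`T4ShellCount.shellBelow_le_largeInd` + file 1's
  `largeInd_mul_exp_neg_wilsonLoc_le_of_Uk_dev_ge` at the weight `ζ∕2`); `shellBelow_sup_mul_exp_neg_wilsonLoc_le_half` — the (2.17) slot
  variable itself, `u := sup_{p ∈ S}|U_k(V)(∂p) − 1|`.
* §2 INTEGRATED — THE PER-SLOT SHELL RATIO (`T4ShellMeasure.SlotLedger.slot` ∕ `T4ShellCount.AgeLedger.ratio` shape): along any measure `ν` on a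
  space `Ω` carrying the step's configuration `Φ`, the slot variable `u` and the REST `R ≥ 0` of the term's density, with the NE7b-type
  normalisation ratio `∫ e^{−A(ζ∕2,Φ)}R ≤ C₂₀ ∫ e^{−A(ζ,Φ)}R` (in-edge N20, displayed): `integral_shell_wilson_le_of_ratio_box_Uk` (n21-a's
  `integral_shell_wilson_le_of_ratio` with the three binders GONE), `integral_shell_wilson_le_of_ratio_of_Uk_dev_ge` ((2.17) form),
  `sum_integral_shell_wilson_le_of_ratio_of_Uk_dev_ge` (summed over a finite term class, the ratio asked ONCE for the class totals).
* §3 VACUITY GUARD: `shellFactor_levelZero` — §1's (2.17) factor FIRES at every member `(K, 0)` with `B₃ = 7` (file 1's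
  `thm1_objects_levelZero'`, `ukRows_levelZero`): the displayed N07∕₈a inputs are theorems at the trivial level.

HONEST FRAMING.  Count-neutral junction by name; nothing of Bałaban's asserted — N07's Theorem-1 slot (levels `k ≥ 1` = Bałaban's theorem,
proved nowhere in the tree), ₈a's rows G₈a-1∕G₈a-3 for regular data and the N20 ratio stay DISPLAYED.  The ratio constant is `K`-INDEPENDENT:
what these theorems give is the `T4ShellCount.LoweredThresholdSuppression`-type UNIFORM budget of a slot, NOT `ShellWeightBound.summable` (the
count × suppression wall `T4ShellCount.not_summable_of_printedShapes_saturated` stands; the level gain is N16's species).  `U_k` = the one-scale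
member of the (2.12) solution map (file 1's located scope).  (M1) `SlotAntiConcentration` untouched; NE7c NOT PRINTED and NOT PROVED; one
finite four-torus at fixed `ε`; nothing continuum ∕ ℝ⁴ ∕ OS ∕ mass-gap ∕ Clay.
-/

set_option autoImplicit false

noncomputable section

namespace Summit.QuantumFields.YangMills.Theorems.N21ShellFactorAtMinimiser

open MeasureTheory
open Literature.MathematicalPhysics.QuantumFieldTheory.Balaban1983to89
open T4Continuum (T4Family)
open B12GaugeOrbits021 (OrbitRel)
open Node00 (SU avOfRecord InUkClassB11 UkExists Uk)
open GaugeField (plaqHol)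
open B15.PrelimIntegrations (Chi175)
open B15Extension193 (outBonds outPlaqs boxSites)
open B15ShellGauge193 (extension193_shell_box)
open B16Sect1Wilson (wilsonLoc)
open T4IndicatorShell (largeInd shellBelow shellBelow_nonneg)
open T4ShellCount (shellBelow_le_largeInd)
open B15Chi175LargeFieldFactor (hcmp_specialUnitaryGroup)
open N21RegularityTransferJunction (eta_pos two_mul_N_pos hreg_Uk_of_thm1_objects largeInd_mul_exp_neg_wilsonLoc_le_of_Uk_dev_ge
  thm1_objects_levelZero' ukRows_levelZero)

variable {F : T4Family} {N : ℕ} [NeZero N]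

section Thm1Objects

variable {K k : ℕ} {a₀ a₁ B₃ : ℝ}

/- N07's THEOREM-1 SLOT AT OBJECTS for the member `(K, k)` — file 1's displayed hypothesis VERBATIM (the per-member body of
`B11Thm1CarrierT.objects_of_thm1Printed`). -/
variable (hT1 : ∀ ε₁ : ℝ, 0 < ε₁ → ε₁ ≤ a₁ → ∀ V : GaugeField (F.P K) k (SU N), PlaqSmall ε₁ V →
    (∃ U : GaugeField (F.P K) 0 (SU N),
        IsBackground (avOfRecord F N K) {U | InUkClassB11 F N K k (B₃ * ε₁) U} k V U) ∧
    (∀ ε₀ : ℝ, B₃ * ε₁ ≤ ε₀ → ε₀ ≤ a₀ → ∀ U U' : GaugeField (F.P K) 0 (SU N),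
        IsBackground (avOfRecord F N K) {U | InUkClassB11 F N K k (B₃ * ε₁) U} k V U →
        IsBackground (avOfRecord F N K) {U | InUkClassB11 F N K k ε₀ U} k V U' →
          InUkClassB11 F N K k ε₀ U ∧ OrbitRel k U U'))

variable {ε₀ : ℝ}

/- ₈a's rows G₈a-1 ∧ G₈a-3 (diagonal) FOR REGULAR DATA at the class radius `ε₀` — file 1's displayed hypothesis VERBATIM. -/
variable (hUk : ∀ (V : GaugeField (F.P K) k (SU N)) (δ : ℝ), 0 < δ → δ ≤ a₁ → B₃ * δ ≤ ε₀ → PlaqSmall δ V →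
    UkExists F N K k ε₀ V ∧ InUkClassB11 F N K k ε₀ (Uk F N K k ε₀ V))

include hT1 hUk

/-! ## §1. Pointwise, at half weight -/

/-- **THE (1.75) SLOT AT THE MINIMISER OF RECORD, POINTWISE AT HALF WEIGHT** (n21-a's `shellBelow_mul_exp_neg_wilsonLoc_le_half` with
`hext := extension193_shell_box`, `hreg :=` file 1's `hreg_Uk_of_thm1_objects`, `hcmp := hcmp_specialUnitaryGroup`): `Λ` a parallelepiped
(`≤ n + 1 ≤ M` sites per direction, non-wrapping with margin, `d = 4`), `ζ ≥ 0` with `ζ ≥ w` outside the box, a tested variable `u` whose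
lowered large-field event `{2ε′η_k² ≤ u}` says `χ_{k,Λ}(V) = 0` at `2ε′η_k²` read through `U_k`:
`1[2ε_kη_k² − 2(ε_k − ε′)η_k² ≤ u < 2ε_kη_k²]·e^{−A(ζ,V)} ≤ e^{−(w∕2)(2N)⁻¹(((48d+1)B₃M²)⁻¹ε′)²}·e^{−A(ζ∕2,V)}`.  CONDITIONAL on N07's slot,
₈a's rows, `hu`; nothing of Bałaban's asserted. [folklore] -/
theorem shellBelow_mul_exp_neg_wilsonLoc_le_half_box_Uk (hB₃ : 0 < B₃) (hhi : ε₀ ≤ a₀) (S : Set (Plaq (F.P K) 0))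
    {lo hi : Fin (F.P K).d → ℤ} (hlohi : lo ≤ hi) {n : ℕ} (hn : ∀ κ, hi κ ≤ lo κ + n)
    (hN : ∀ κ, hi κ - lo κ + 3 < ((F.P K).sitesPerDir k : ℤ)) {M : ℝ} (hM : (n : ℝ) + 1 ≤ M) {ε' εk w : ℝ} (hε' : 0 < ε')
    (hε'w : B₃⁻¹ * ε' ≤ min a₁ (ε₀ / B₃)) (ζ : Plaq (F.P K) k → ℝ) (hζ : ∀ p, 0 ≤ ζ p)
    (hw : ∀ p ∈ outPlaqs (boxSites (k := k) lo hi), w ≤ ζ p) {V : GaugeField (F.P K) k (SU N)} {u : ℝ}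
    (hu : 2 * ε' * (F.P K).eta k ^ 2 ≤ u → ¬ Chi175 (fun (e : {W : GaugeField (F.P K) k (SU N) //
      ∀ b ∈ outBonds (boxSites lo hi), W b = V b}) (p : Plaq (F.P K) 0) => dist1 (plaqHol (Uk F N K k ε₀ e.1) p)) S ε'
      ((F.P K).eta k)) :
    shellBelow u (2 * εk * (F.P K).eta k ^ 2) (2 * (εk - ε') * (F.P K).eta k ^ 2) * Real.exp (-wilsonLoc ζ V) ≤
      Real.exp (-(w / 2 * ((2 * (N : ℝ))⁻¹ * (((48 * ((F.P K).d : ℝ) + 1) * B₃ * M ^ 2)⁻¹ * ε') ^ 2))) *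
        Real.exp (-wilsonLoc (fun p => (1 / 2 : ℝ) * ζ p) V) := by
  have hd : 3 ≤ (F.P K).d := by rw [T4Family.P_d]; norm_num
  have hC : (0 : ℝ) < 48 * ((F.P K).d : ℝ) + 1 := by positivity
  have hM0 : 0 < M := by have : (0 : ℝ) ≤ n := n.cast_nonneg; linarith
  exact shellBelow_mul_exp_neg_wilsonLoc_le_half hC hM0 hB₃ hε' (extension193_shell_box (G := SU N) hd hlohi hn hN hM _)
    (fun W p => dist1 (plaqHol (Uk F N K k ε₀ W) p)) S (hreg_Uk_of_thm1_objects hT1 hUk hB₃ hhi S) hε'w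
    hcmp_specialUnitaryGroup two_mul_N_pos ζ hζ hw hu

/-- **THE (2.17) SLOT AT THE MINIMISER OF RECORD, POINTWISE AT HALF WEIGHT**: for ANY tested variable `u` whose LOWERED large-field event
`{θ' − Δ ≤ u}` forces a `(θ' − Δ)`-large plaquette of `U_k(V)` on `S` (`0 < θ' − Δ` below the ceiling), the shell below the threshold obeys
`1[θ' − Δ ≤ u < θ']·e^{−A(ζ,V)} ≤ e^{−(w∕2)(2N)⁻¹(B₃⁻¹η_k⁻²(θ' − Δ))²}·e^{−A(ζ∕2,V)}` (`ζ ≥ w` everywhere).  `shellBelow ≤ largeInd` at the lowered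
threshold (`T4ShellCount.shellBelow_le_largeInd`) + file 1's factor at the weight `ζ∕2`.  CONDITIONAL on N07's slot, ₈a's rows, `hu`. [folklore] -/
theorem shellBelow_mul_exp_neg_wilsonLoc_le_half_of_Uk_dev_ge (hB₃ : 0 < B₃) (hhi : ε₀ ≤ a₀) (S : Set (Plaq (F.P K) 0))
    {θ' Δ : ℝ} (hθ : 0 < θ' - Δ) (hθw : B₃⁻¹ * ((F.P K).eta k ^ 2)⁻¹ * (θ' - Δ) ≤ min a₁ (ε₀ / B₃))
    (ζ : Plaq (F.P K) k → ℝ) (hζ : ∀ p, 0 ≤ ζ p) {w : ℝ} (hw : ∀ p, w ≤ ζ p) {V : GaugeField (F.P K) k (SU N)} {u : ℝ}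
    (hu : θ' - Δ ≤ u → ∃ p ∈ S, θ' - Δ ≤ dist1 (plaqHol (Uk F N K k ε₀ V) p)) :
    shellBelow u θ' Δ * Real.exp (-wilsonLoc ζ V) ≤
      Real.exp (-(w / 2 * ((2 * (N : ℝ))⁻¹ * (B₃⁻¹ * ((F.P K).eta k ^ 2)⁻¹ * (θ' - Δ)) ^ 2))) *
        Real.exp (-wilsonLoc (fun p => (1 / 2 : ℝ) * ζ p) V) := by
  have hhalf := largeInd_mul_exp_neg_wilsonLoc_le_of_Uk_dev_ge hT1 hUk hB₃ hhi S hθ hθw (fun p => (1 / 2 : ℝ) * ζ p)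
    (fun p => by have := hζ p; positivity) (w := w / 2) (fun p => by have := hw p; linarith) hu
  have hsh := shellBelow_le_largeInd u θ' Δ
  rw [exp_neg_wilsonLoc_eq_half_mul_half ζ V, ← mul_assoc]
  refine mul_le_mul_of_nonneg_right ?_ (Real.exp_pos _).le
  exact (mul_le_mul_of_nonneg_right hsh (Real.exp_pos _).le).trans hhalf

/-- **THE (2.17) SLOT VARIABLE ITSELF**, `u := sup_{p ∈ S}|U_k(V)(∂p) − 1|` over a nonempty finite `S`: its shell below ANY threshold `θ'`
with lowered threshold `θ' − Δ > 0` under the ceiling carries the half-weight factor. [folklore] -/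
theorem shellBelow_sup_mul_exp_neg_wilsonLoc_le_half (hB₃ : 0 < B₃) (hhi : ε₀ ≤ a₀) (S : Finset (Plaq (F.P K) 0))
    (hS : S.Nonempty) {θ' Δ : ℝ} (hθ : 0 < θ' - Δ) (hθw : B₃⁻¹ * ((F.P K).eta k ^ 2)⁻¹ * (θ' - Δ) ≤ min a₁ (ε₀ / B₃))
    (ζ : Plaq (F.P K) k → ℝ) (hζ : ∀ p, 0 ≤ ζ p) {w : ℝ} (hw : ∀ p, w ≤ ζ p) (V : GaugeField (F.P K) k (SU N)) :
    shellBelow (S.sup' hS fun p => dist1 (plaqHol (Uk F N K k ε₀ V) p)) θ' Δ * Real.exp (-wilsonLoc ζ V) ≤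
      Real.exp (-(w / 2 * ((2 * (N : ℝ))⁻¹ * (B₃⁻¹ * ((F.P K).eta k ^ 2)⁻¹ * (θ' - Δ)) ^ 2))) *
        Real.exp (-wilsonLoc (fun p => (1 / 2 : ℝ) * ζ p) V) :=
  shellBelow_mul_exp_neg_wilsonLoc_le_half_of_Uk_dev_ge hT1 hUk hB₃ hhi (↑S) hθ hθw ζ hζ hw fun h => by
    obtain ⟨p, hp, hle⟩ := (Finset.le_sup'_iff hS).1 h
    exact ⟨p, Finset.mem_coe.2 hp, hle⟩

/-! ## §2. Integrated: the per-slot shell RATIO -/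

variable {Ω : Type*} [MeasurableSpace Ω] (ν : Measure Ω)

/-- **N07 ⊗ N12 ⊗ N20, INTEGRATED — THE (1.75) SLOT's SHELL RATIO AT THE MINIMISER OF RECORD** (n21-a's `integral_shell_wilson_le_of_ratio`
with `hext`, `hreg`, `hcmp` discharged): along `ν` with configuration `Φ`, tested variable `u`, rest `R ≥ 0`, the half-coupling density integrable
against the rest, and the NE7b-type ratio `∫ e^{−A(ζ∕2,Φ)}R ≤ C₂₀ ∫ e^{−A(ζ,Φ)}R` (in-edge N20, displayed):
`∫ 1[shell](u)·e^{−A(ζ,Φ)}·R ≤ (e^{−(w∕2)(2N)⁻¹(((48d+1)B₃M²)⁻¹ε′)²}·C₂₀)·∫ e^{−A(ζ,Φ)}·R`.  CONDITIONAL on N07's slot, ₈a's rows, `hu`,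
`hratio`; NOT `ShellWeightBound` (K-independent ratio ⇒ uniform budget only). [folklore] -/
theorem integral_shell_wilson_le_of_ratio_box_Uk (hB₃ : 0 < B₃) (hhi : ε₀ ≤ a₀) (S : Set (Plaq (F.P K) 0))
    {lo hi : Fin (F.P K).d → ℤ} (hlohi : lo ≤ hi) {n : ℕ} (hn : ∀ κ, hi κ ≤ lo κ + n)
    (hN : ∀ κ, hi κ - lo κ + 3 < ((F.P K).sitesPerDir k : ℤ)) {M : ℝ} (hM : (n : ℝ) + 1 ≤ M) {ε' εk w : ℝ} (hε' : 0 < ε')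
    (hε'w : B₃⁻¹ * ε' ≤ min a₁ (ε₀ / B₃)) (ζ : Plaq (F.P K) k → ℝ) (hζ : ∀ p, 0 ≤ ζ p)
    (hw : ∀ p ∈ outPlaqs (boxSites (k := k) lo hi), w ≤ ζ p) (Φ : Ω → GaugeField (F.P K) k (SU N)) (u : Ω → ℝ) {R : Ω → ℝ}
    (hR : ∀ ω, 0 ≤ R ω)
    (hu : ∀ ω, 2 * ε' * (F.P K).eta k ^ 2 ≤ u ω → ¬ Chi175 (fun (e : {W : GaugeField (F.P K) k (SU N) //
      ∀ b ∈ outBonds (boxSites lo hi), W b = Φ ω b}) (p : Plaq (F.P K) 0) => dist1 (plaqHol (Uk F N K k ε₀ e.1) p)) S ε'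
      ((F.P K).eta k))
    (hint : Integrable (fun ω => Real.exp (-wilsonLoc (fun p => (1 / 2 : ℝ) * ζ p) (Φ ω)) * R ω) ν) {C₂₀ : ℝ}
    (hratio : ∫ ω, Real.exp (-wilsonLoc (fun p => (1 / 2 : ℝ) * ζ p) (Φ ω)) * R ω ∂ν ≤
      C₂₀ * ∫ ω, Real.exp (-wilsonLoc ζ (Φ ω)) * R ω ∂ν) :
    ∫ ω, shellBelow (u ω) (2 * εk * (F.P K).eta k ^ 2) (2 * (εk - ε') * (F.P K).eta k ^ 2) *
        Real.exp (-wilsonLoc ζ (Φ ω)) * R ω ∂ν ≤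
      (Real.exp (-(w / 2 * ((2 * (N : ℝ))⁻¹ * (((48 * ((F.P K).d : ℝ) + 1) * B₃ * M ^ 2)⁻¹ * ε') ^ 2))) * C₂₀) *
        ∫ ω, Real.exp (-wilsonLoc ζ (Φ ω)) * R ω ∂ν := by
  have hd : 3 ≤ (F.P K).d := by rw [T4Family.P_d]; norm_num
  have hC : (0 : ℝ) < 48 * ((F.P K).d : ℝ) + 1 := by positivity
  have hM0 : 0 < M := by have : (0 : ℝ) ≤ n := n.cast_nonneg; linarith
  exact integral_shell_wilson_le_of_ratio ν hC hM0 hB₃ hε' (extension193_shell_box (G := SU N) hd hlohi hn hN hM _)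
    (fun W p => dist1 (plaqHol (Uk F N K k ε₀ W) p)) S (hreg_Uk_of_thm1_objects hT1 hUk hB₃ hhi S) hε'w
    hcmp_specialUnitaryGroup two_mul_N_pos ζ hζ hw Φ u hR hu hint hratio

/-- **THE (2.17) SLOT's SHELL RATIO AT THE MINIMISER OF RECORD, INTEGRATED** (n21-a's abstract `integral_shell_le_of_pointwise_of_ratio` fed
with §1's (2.17) factor): `∫ 1[θ' − Δ ≤ u < θ']·e^{−A(ζ,Φ)}·R ≤ (e^{−(w∕2)(2N)⁻¹(B₃⁻¹η_k⁻²(θ' − Δ))²}·C₂₀)·∫ e^{−A(ζ,Φ)}·R`, the slot implication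
`hu` asked at every `ω`.  CONDITIONAL on N07's slot, ₈a's rows, `hu`, `hratio`. [folklore] -/
theorem integral_shell_wilson_le_of_ratio_of_Uk_dev_ge (hB₃ : 0 < B₃) (hhi : ε₀ ≤ a₀) (S : Set (Plaq (F.P K) 0))
    {θ' Δ : ℝ} (hθ : 0 < θ' - Δ) (hθw : B₃⁻¹ * ((F.P K).eta k ^ 2)⁻¹ * (θ' - Δ) ≤ min a₁ (ε₀ / B₃))
    (ζ : Plaq (F.P K) k → ℝ) (hζ : ∀ p, 0 ≤ ζ p) {w : ℝ} (hw : ∀ p, w ≤ ζ p) (Φ : Ω → GaugeField (F.P K) k (SU N))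
    (u : Ω → ℝ) {R : Ω → ℝ} (hR : ∀ ω, 0 ≤ R ω)
    (hu : ∀ ω, θ' - Δ ≤ u ω → ∃ p ∈ S, θ' - Δ ≤ dist1 (plaqHol (Uk F N K k ε₀ (Φ ω)) p))
    (hint : Integrable (fun ω => Real.exp (-wilsonLoc (fun p => (1 / 2 : ℝ) * ζ p) (Φ ω)) * R ω) ν) {C₂₀ : ℝ}
    (hratio : ∫ ω, Real.exp (-wilsonLoc (fun p => (1 / 2 : ℝ) * ζ p) (Φ ω)) * R ω ∂ν ≤
      C₂₀ * ∫ ω, Real.exp (-wilsonLoc ζ (Φ ω)) * R ω ∂ν) :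
    ∫ ω, shellBelow (u ω) θ' Δ * Real.exp (-wilsonLoc ζ (Φ ω)) * R ω ∂ν ≤
      (Real.exp (-(w / 2 * ((2 * (N : ℝ))⁻¹ * (B₃⁻¹ * ((F.P K).eta k ^ 2)⁻¹ * (θ' - Δ)) ^ 2))) * C₂₀) *
        ∫ ω, Real.exp (-wilsonLoc ζ (Φ ω)) * R ω ∂ν :=
  integral_shell_le_of_pointwise_of_ratio ν (s := fun ω => shellBelow (u ω) θ' Δ)
    (w := fun ω => Real.exp (-wilsonLoc ζ (Φ ω))) (w' := fun ω => Real.exp (-wilsonLoc (fun p => (1 / 2 : ℝ) * ζ p) (Φ ω)))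
    (fun _ => shellBelow_nonneg _ _ _) (fun _ => (Real.exp_pos _).le) hR (Real.exp_pos _).le
    (fun ω => shellBelow_mul_exp_neg_wilsonLoc_le_half_of_Uk_dev_ge hT1 hUk hB₃ hhi S hθ hθw ζ hζ hw (hu ω)) hint hratio

/-- **… SUMMED OVER A FINITE TERM CLASS** (the shape of `T4ShellMeasure.SlotLedger.slot` ∕ `T4ShellCount.AgeLedger.ratio`; n21-a's
`sum_integral_shell_le_of_ratio` BY NAME): per term `τ` its own rest `R τ ≥ 0`, the N20-type ratio asked ONCE for the class totals,
`Σ_τ ∫ 1[shell](u)·e^{−A(ζ,Φ)}·R_τ ≤ (e^{−(w∕2)(2N)⁻¹(B₃⁻¹η_k⁻²(θ' − Δ))²}·C₂₀)·Σ_τ ∫ e^{−A(ζ,Φ)}·R_τ`. [folklore] -/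
theorem sum_integral_shell_wilson_le_of_ratio_of_Uk_dev_ge (hB₃ : 0 < B₃) (hhi : ε₀ ≤ a₀) (S : Set (Plaq (F.P K) 0))
    {θ' Δ : ℝ} (hθ : 0 < θ' - Δ) (hθw : B₃⁻¹ * ((F.P K).eta k ^ 2)⁻¹ * (θ' - Δ) ≤ min a₁ (ε₀ / B₃))
    (ζ : Plaq (F.P K) k → ℝ) (hζ : ∀ p, 0 ≤ ζ p) {w : ℝ} (hw : ∀ p, w ≤ ζ p) (Φ : Ω → GaugeField (F.P K) k (SU N))
    (u : Ω → ℝ) {ι : Type*} (T : Finset ι) {R : ι → Ω → ℝ} (hR : ∀ τ ∈ T, ∀ ω, 0 ≤ R τ ω)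
    (hu : ∀ ω, θ' - Δ ≤ u ω → ∃ p ∈ S, θ' - Δ ≤ dist1 (plaqHol (Uk F N K k ε₀ (Φ ω)) p))
    (hint : ∀ τ ∈ T, Integrable (fun ω => Real.exp (-wilsonLoc (fun p => (1 / 2 : ℝ) * ζ p) (Φ ω)) * R τ ω) ν) {C₂₀ : ℝ}
    (hratio : ∑ τ ∈ T, ∫ ω, Real.exp (-wilsonLoc (fun p => (1 / 2 : ℝ) * ζ p) (Φ ω)) * R τ ω ∂ν ≤
      C₂₀ * ∑ τ ∈ T, ∫ ω, Real.exp (-wilsonLoc ζ (Φ ω)) * R τ ω ∂ν) :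
    ∑ τ ∈ T, ∫ ω, shellBelow (u ω) θ' Δ * Real.exp (-wilsonLoc ζ (Φ ω)) * R τ ω ∂ν ≤
      (Real.exp (-(w / 2 * ((2 * (N : ℝ))⁻¹ * (B₃⁻¹ * ((F.P K).eta k ^ 2)⁻¹ * (θ' - Δ)) ^ 2))) * C₂₀) *
        ∑ τ ∈ T, ∫ ω, Real.exp (-wilsonLoc ζ (Φ ω)) * R τ ω ∂ν :=
  sum_integral_shell_le_of_ratio ν T (s := fun ω => shellBelow (u ω) θ' Δ) (w := fun ω => Real.exp (-wilsonLoc ζ (Φ ω)))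
    (w' := fun ω => Real.exp (-wilsonLoc (fun p => (1 / 2 : ℝ) * ζ p) (Φ ω)))
    (fun _ => shellBelow_nonneg _ _ _) (fun _ => (Real.exp_pos _).le) hR (Real.exp_pos _).le
    (fun ω => shellBelow_mul_exp_neg_wilsonLoc_le_half_of_Uk_dev_ge hT1 hUk hB₃ hhi S hθ hθw ζ hζ hw (hu ω)) hint hratio

end Thm1Objects

/-! ## §3. Vacuity guard: the (2.17) factor fires at every member `(K, 0)` -/

/-- **THE JUNCTION FIRES AT LEVEL 0** (`B₃ = 7`; N07's slot and ₈a's rows are THEOREMS at the trivial level — file 1's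
`thm1_objects_levelZero'`, `ukRows_levelZero`): the (2.17) shell factor of §1 holds OUTRIGHT for `U_0`, for every weight `ζ ≥ w`, every slot range
`S`, every threshold pair with `0 < θ' − Δ`, `7⁻¹η_0⁻²(θ' − Δ) ≤ min a₁ (ε₀∕7)`, `ε₀ ≤ a₀`.  Nothing about `k ≥ 1`. [folklore] -/
theorem shellFactor_levelZero (K : ℕ) {a₀ a₁ ε₀ : ℝ} (hhi : ε₀ ≤ a₀) (S : Set (Plaq (F.P K) 0)) {θ' Δ : ℝ} (hθ : 0 < θ' - Δ)
    (hθw : 7⁻¹ * ((F.P K).eta 0 ^ 2)⁻¹ * (θ' - Δ) ≤ min a₁ (ε₀ / 7)) (ζ : Plaq (F.P K) 0 → ℝ) (hζ : ∀ p, 0 ≤ ζ p) {w : ℝ}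
    (hw : ∀ p, w ≤ ζ p) {V : GaugeField (F.P K) 0 (SU N)} {u : ℝ}
    (hu : θ' - Δ ≤ u → ∃ p ∈ S, θ' - Δ ≤ dist1 (plaqHol (Uk F N K 0 ε₀ V) p)) :
    shellBelow u θ' Δ * Real.exp (-wilsonLoc ζ V) ≤
      Real.exp (-(w / 2 * ((2 * (N : ℝ))⁻¹ * (7⁻¹ * ((F.P K).eta 0 ^ 2)⁻¹ * (θ' - Δ)) ^ 2))) *
        Real.exp (-wilsonLoc (fun p => (1 / 2 : ℝ) * ζ p) V) :=
  shellBelow_mul_exp_neg_wilsonLoc_le_half_of_Uk_dev_ge (thm1_objects_levelZero' K a₀ a₁) (ukRows_levelZero K a₁ ε₀)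
    (by norm_num) hhi S hθ hθw ζ hζ hw hu

end Summit.QuantumFields.YangMills.Theorems.N21ShellFactorAtMinimiser

end
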